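import Summits.RiemannHypothesis.RiemannHypothesis.Theorems.JensenLogBandArcDescentR2
import HarnessLib

/-!
# Sharp global descent in the bounded-radius regime, part 3: the lead's flank interface
# (BAND crux, R2 input F6c)

RH ladder column JENSEN, rung J-P(P3) «log band», BAND crux `XiDerivBandRealAllRates`
(stmt-RiemannHypothesis-19913) of route «JensenLogBand», line «band-one-window» (u-arc reshape;
BAND lead rh-jensen-prover g8) — regime-(R2) flank input for the assembly step S5-2 in the interface
asked for by the lead (STATUS 04:19:11Z): `‖I(θ)‖ ≤ C·‖I(φ₀)‖·e^{−κ(n+1)(1 − cos(θ − φ₀))}` with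
`κ = 1`, `C = e^{12h + 6}` in R2 (`h ≤ 20`). RH-FREE `Γ`-factor calculus. WHAT THIS IS NOT: nothing
here bears on zeros of `ζ` or the truth of RH.

* `saddle_sin_cost` — `(n+1)|sin φ₀| ≤ 25/16 + (5/2) h` (`(n+1)|Im(u*−c)|/r ≤ (hℓ/2) ε/(16h/25)`);
* **`norm_arcModelIntegrand_le_descent_R2_sub`**: for `|θ| < π/2`,
  `‖I_r(θ)‖ ≤ e^{12h + 6} · ‖I_r(φ₀)‖ · exp(−(n+1)(1 − cos(θ − φ₀)))`, from part 2's
  `exp(−(n+1)(cos φ₀ − cos θ))` form via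
  `1 − cos(θ−φ₀) = (cos φ₀ − cos θ) + (1 − cos φ₀)(1 + cos θ) − sin θ sin φ₀`.

(prover-rh-jensen-eng-2-g6-0, 2026-08-27.)
-/

noncomputable section

-- single-problem summit: `Summit.RiemannHypothesis.RiemannHypothesis.…` is the tree convention
set_option linter.dupNamespace false

open Complex Real Set

namespace Summit.RiemannHypothesis.RiemannHypothesis.Theorems.JensenPolynomials.LogBandArc

open Literature.NumberTheory.LFunctions

variable {n : ℕ} {x T : ℝ} {u : ℂ}

/-- **The saddle angle's sine costs a constant:** `(n+1)|sin φ₀| ≤ 25/16 + (5/2) h` in regime R2.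
[folklore] -/
theorem saddle_sin_cost (hx : |x| ≤ 1 / 2) (hT : 100 ≤ T)
    (hℓ : 20 ≤ ell T) (hn : 100 ≤ n) (hh : 1 / 2 ≤ bandRadius n T)
    (hhT : bandRadius n T ≤ 7 / 20 * T) (hH : bandRadius n T ≤ 20)
    (hu : ‖u - ((x : ℂ) + (T : ℂ) * I + bandRadius n T)‖ ≤ 3 / 5 * bandRadius n T)
    (hS : arcSaddleFn n ((x : ℂ) + (T : ℂ) * I) u = 0) :
    ((n : ℝ) + 1) * |Real.sin (Complex.arg (u - ((x : ℂ) + (T : ℂ) * I)))| ≤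
      25 / 16 + 5 / 2 * bandRadius n T := by
  obtain ⟨-, hεh, -, -, -⟩ := R2_bookkeeping hT hℓ hh hH
  obtain ⟨-, him_abs, hr_lo, -⟩ := arcSaddle_sharp_polar hx hT hℓ hn hh hhT hH hu hS
  have hℓ0 : 0 < ell T := by linarith
  have hεℓ : (2 + 16 / 5 * bandRadius n T) / ell T * ell T = 2 + 16 / 5 * bandRadius n T :=
    div_mul_cancel₀ _ hℓ0.ne'
  have hhℓ : bandRadius n T * ell T = 2 * ((n : ℝ) + 1) := bandRadius_mul_ell hℓ
  have hu_eq : circleMap ((x : ℂ) + (T : ℂ) * I) ‖u - ((x : ℂ) + (T : ℂ) * I)‖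
      (Complex.arg (u - ((x : ℂ) + (T : ℂ) * I))) = u := circleMap_norm_arg _ u
  have huim := (circleMap_sub_re_im ((x : ℂ) + (T : ℂ) * I) ‖u - ((x : ℂ) + (T : ℂ) * I)‖
    (Complex.arg (u - ((x : ℂ) + (T : ℂ) * I)))).2
  rw [hu_eq] at huim
  generalize hε' : (2 + 16 / 5 * bandRadius n T) / ell T = ε at *
  generalize hh' : bandRadius n T = h at *
  generalize hℓ' : ell T = ℓ at *
  generalize hφ' : Complex.arg (u - ((x : ℂ) + (T : ℂ) * I)) = φ₀ at *
  generalize hr' : ‖u - ((x : ℂ) + (T : ℂ) * I)‖ = r at *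
  have hh0 : 0 < h := by linarith only [hh]
  have hrlo' : 16 / 25 * h ≤ r := by linarith only [hr_lo, hεh]
  have hr0 : 0 < r := by linarith only [hrlo', hh0]
  have him_le : |r * Real.sin φ₀| ≤ ε := by rw [← huim]; exact him_abs
  rw [abs_mul, abs_of_pos hr0] at him_le
  have hs0 : 0 ≤ |Real.sin φ₀| := abs_nonneg _
  -- `(n+1)|sin φ₀| r = (hℓ/2)|sin φ₀| r ≤ (hℓ/2) ε = (1 + 8h/5) h`
  have hn1 : ((n : ℝ) + 1) = h * ℓ / 2 := by linarith only [hhℓ]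
  have h1 : ((n : ℝ) + 1) * |Real.sin φ₀| * r ≤ (h * ℓ / 2) * ε := by
    rw [hn1, mul_assoc]
    exact mul_le_mul_of_nonneg_left (by linarith only [him_le, mul_comm r |Real.sin φ₀|])
      (by positivity)
  have h2 : (h * ℓ / 2) * ε = (1 + 8 / 5 * h) * h := by
    have e : (h * ℓ / 2) * ε = (ε * ℓ) * h / 2 := by ring
    rw [e, hεℓ]; ring
  -- divide by `r ≥ 16h/25`
  have h3 : ((n : ℝ) + 1) * |Real.sin φ₀| * (16 / 25 * h) ≤ (1 + 8 / 5 * h) * h := by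
    have := mul_le_mul_of_nonneg_left hrlo' (show 0 ≤ ((n : ℝ) + 1) * |Real.sin φ₀| by positivity)
    linarith only [this, h1, h2]
  have h4 : ((n : ℝ) + 1) * |Real.sin φ₀| * (16 / 25 * h) ≤ (25 / 16 + 5 / 2 * h) * (16 / 25 * h) := by
    have e : (1 + 8 / 5 * h) * h = (25 / 16 + 5 / 2 * h) * (16 / 25 * h) := by ring
    linarith only [h3, e]
  exact le_of_mul_le_mul_right h4 (by positivity)

/-- **Sharp R2 descent in the lead's flank interface:** for `|θ| < π/2`,
`‖I_r(θ)‖ ≤ e^{12h + 6} · ‖I_r(φ₀)‖ · exp(−(n+1)(1 − cos(θ − φ₀)))` — descent constant `κ = 1`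
exactly, constant `C = e^{12h+6}` (regime R2: `h ≤ 20`). [folklore] -/
theorem norm_arcModelIntegrand_le_descent_R2_sub (hx : |x| ≤ 1 / 2) (hT : 100 ≤ T)
    (hℓ : 20 ≤ ell T) (hn : 100 ≤ n) (hh : 1 / 2 ≤ bandRadius n T)
    (hhT : bandRadius n T ≤ 7 / 20 * T) (hH : bandRadius n T ≤ 20)
    (hu : ‖u - ((x : ℂ) + (T : ℂ) * I + bandRadius n T)‖ ≤ 3 / 5 * bandRadius n T)
    (hS : arcSaddleFn n ((x : ℂ) + (T : ℂ) * I) u = 0) {θ : ℝ} (hθ : |θ| < Real.pi / 2) :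
    ‖arcModelIntegrand n ‖u - ((x : ℂ) + (T : ℂ) * I)‖ ((x : ℂ) + (T : ℂ) * I) θ‖ ≤
      Real.exp (12 * bandRadius n T + 6) *
        ‖arcModelIntegrand n ‖u - ((x : ℂ) + (T : ℂ) * I)‖ ((x : ℂ) + (T : ℂ) * I)
          (Complex.arg (u - ((x : ℂ) + (T : ℂ) * I)))‖ *
        Real.exp (-(((n : ℝ) + 1) *
          (1 - Real.cos (θ - Complex.arg (u - ((x : ℂ) + (T : ℂ) * I)))))) := by
  have hmain := norm_arcModelIntegrand_le_descent_R2 hx hT hℓ hn hh hhT hH hu hS hθ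
  have hcos := saddle_angle_cost hx hT hℓ hn hh hhT hH hu hS
  have hsin := saddle_sin_cost hx hT hℓ hn hh hhT hH hu hS
  have hh0 : 0 < bandRadius n T := by linarith only [hh]
  generalize hh' : bandRadius n T = h at *
  generalize hφ' : Complex.arg (u - ((x : ℂ) + (T : ℂ) * I)) = φ₀ at *
  generalize hr' : ‖u - ((x : ℂ) + (T : ℂ) * I)‖ = r at *
  generalize hI' : ‖arcModelIntegrand n r ((x : ℂ) + (T : ℂ) * I) θ‖ = A at *
  generalize hI0' : ‖arcModelIntegrand n r ((x : ℂ) + (T : ℂ) * I) φ₀‖ = A₀ at *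
  have hA₀ : 0 ≤ A₀ := by rw [← hI0']; exact norm_nonneg _
  have hcosθ : 0 < Real.cos θ := Real.cos_pos_of_mem_Ioo (abs_lt.1 hθ)
  have hcosθ1 : Real.cos θ ≤ 1 := Real.cos_le_one θ
  have hsinθ : |Real.sin θ| ≤ 1 := Real.abs_sin_le_one θ
  -- `(n+1)(1 − cos(θ−φ₀)) ≤ (n+1)(cos φ₀ − cos θ) + 2(22/25 + 1.41h) + (25/16 + 5h/2)`
  have hkey : ((n : ℝ) + 1) * (1 - Real.cos (θ - φ₀)) ≤
      ((n : ℝ) + 1) * (Real.cos φ₀ - Real.cos θ) + (2 * (22 / 25 + 141 / 100 * h) + (25 / 16 + 5 / 2 * h)) := by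
    rw [Real.cos_sub]
    have e : ((n : ℝ) + 1) * (1 - (Real.cos θ * Real.cos φ₀ + Real.sin θ * Real.sin φ₀)) =
        ((n : ℝ) + 1) * (Real.cos φ₀ - Real.cos θ) +
          ((n : ℝ) + 1) * (1 - Real.cos φ₀) * (1 + Real.cos θ) -
          Real.sin θ * (((n : ℝ) + 1) * Real.sin φ₀) := by ring
    rw [e]
    have hc0 : 0 ≤ ((n : ℝ) + 1) * (1 - Real.cos φ₀) :=
      mul_nonneg (by positivity) (by linarith only [Real.cos_le_one φ₀])
    have h1 : ((n : ℝ) + 1) * (1 - Real.cos φ₀) * (1 + Real.cos θ) ≤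
        (22 / 25 + 141 / 100 * h) * 2 :=
      mul_le_mul hcos (by linarith only [hcosθ1]) (by linarith only [hcosθ]) (by positivity)
    have h2 : |Real.sin θ * (((n : ℝ) + 1) * Real.sin φ₀)| ≤ 25 / 16 + 5 / 2 * h := by
      rw [abs_mul]
      have h3 : |((n : ℝ) + 1) * Real.sin φ₀| = ((n : ℝ) + 1) * |Real.sin φ₀| := by
        rw [abs_mul, abs_of_nonneg (by positivity)]
      rw [h3]
      calc |Real.sin θ| * (((n : ℝ) + 1) * |Real.sin φ₀|) ≤ 1 * (((n : ℝ) + 1) * |Real.sin φ₀|) :=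
            mul_le_mul_of_nonneg_right hsinθ (by positivity)
        _ ≤ 25 / 16 + 5 / 2 * h := by rw [one_mul]; exact hsin
    have h2' := (abs_le.1 h2).1
    linarith only [h1, h2']
  have hexp : Real.exp (-(((n : ℝ) + 1) * (Real.cos φ₀ - Real.cos θ))) ≤
      Real.exp (2 * (22 / 25 + 141 / 100 * h) + (25 / 16 + 5 / 2 * h)) *
        Real.exp (-(((n : ℝ) + 1) * (1 - Real.cos (θ - φ₀)))) := by
    rw [← Real.exp_add]
    exact Real.exp_le_exp.2 (by linarith only [hkey])
  have hC0 : 0 ≤ Real.exp (6 * h + 2) * A₀ := mul_nonneg (Real.exp_pos _).le hA₀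
  calc A ≤ Real.exp (6 * h + 2) * A₀ * Real.exp (-(((n : ℝ) + 1) * (Real.cos φ₀ - Real.cos θ))) := hmain
    _ ≤ Real.exp (6 * h + 2) * A₀ * (Real.exp (2 * (22 / 25 + 141 / 100 * h) + (25 / 16 + 5 / 2 * h)) *
        Real.exp (-(((n : ℝ) + 1) * (1 - Real.cos (θ - φ₀))))) :=
        mul_le_mul_of_nonneg_left hexp hC0
    _ = (Real.exp (6 * h + 2) * Real.exp (2 * (22 / 25 + 141 / 100 * h) + (25 / 16 + 5 / 2 * h))) *
        A₀ * Real.exp (-(((n : ℝ) + 1) * (1 - Real.cos (θ - φ₀)))) := by ring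
    _ ≤ Real.exp (12 * h + 6) * A₀ * Real.exp (-(((n : ℝ) + 1) * (1 - Real.cos (θ - φ₀)))) := by
        apply mul_le_mul_of_nonneg_right _ (Real.exp_pos _).le
        apply mul_le_mul_of_nonneg_right _ hA₀
        rw [← Real.exp_add]
        exact Real.exp_le_exp.2 (by linarith only [hh0])

end Summit.RiemannHypothesis.RiemannHypothesis.Theorems.JensenPolynomials.LogBandArc

end
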